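import Mathlib.NumberTheory.Padics.Hensel
import Mathlib.NumberTheory.Padics.RingHoms
import HarnessLib

/-!
# Squares in `ℚ_p`: Hensel lifts and integral representatives of square classes

Topic `NumberTheory/QuadraticForms`; namespace `Literature.NumberTheory.QuadraticForms`. Everything
here is proved, for Mathlib's `ℚ_[p]`, `ℤ_[p]` and every prime `p`.

* `padicInt_isSquare_of_toZModPow_three_eq_one` — a `p`-adic integer `≡ 1 (mod p³)` is a square
  (Hensel's lemma for `X² - u` at `1`: `‖1 - u‖ ≤ p⁻³ < ‖2‖²`; for `p = 2` this is Serre,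
  *A Course in Arithmetic*, Ch. II §3.3 Thm 4 "`1 + 8ℤ₂ ⊆ ℤ₂²`", for odd `p` a weak form of
  Thm 3).
* `padicInt_isSquare_of_toZMod_eq_one` — for odd `p`, a `p`-adic integer `≡ 1 (mod p)` is a
  square (Ch. II §3.3 Thm 3: a unit is a square iff its residue is).
* `padic_exists_intCast_mul_sq` — **every non-zero `x ∈ ℚ_p` is `n s²` with `n` a non-zero
  integer**: by density of `ℚ` pick `r ∈ ℚ` with `‖x - r‖ < p⁻³ ‖x‖`; then `x / r ≡ 1 (mod p³)`
  is a square, and `r = (num · den) (1/den)²`. (So every square class of `ℚ_p^*` has an integer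
  representative, which reduces statements about the Hilbert symbol of `ℚ_p` to Serre's explicit
  formulas for integers, Ch. III §1.2 Thm 1.)

## References

* J.-P. Serre, *A Course in Arithmetic*, GTM 7, Springer 1973, Ch. II §3.3 Thms 3–4 (PDF
  pp. 17–18 of the held copy). [Serre1973]
-/

noncomputable section

open Polynomial

namespace Literature.NumberTheory.QuadraticForms

variable {p : ℕ} [hp : Fact p.Prime]

/-! ### Hensel's lemma for `X² - u` -/

/-- The norm of `2` in `ℤ_p` satisfies `‖2‖² > p⁻³` (`‖2‖ = 1` for odd `p`, `= 1/2` for `p = 2`).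
[folklore] -/
theorem padicInt_norm_two_sq_gt : (p : ℝ) ^ (-3 : ℤ) < ‖(2 : ℤ_[p])‖ ^ 2 := by
  have hp1 : (1 : ℝ) < p := by exact_mod_cast hp.out.one_lt
  by_cases h2 : p = 2
  · subst h2
    have : ‖(2 : ℤ_[2])‖ = (2 : ℝ)⁻¹ := by exact_mod_cast PadicInt.norm_p (p := 2)
    rw [this]
    norm_num
  · have h2' : ‖(2 : ℤ_[p])‖ = 1 := by
      have hle : ‖((2 : ℤ) : ℤ_[p])‖ ≤ 1 := PadicInt.norm_le_one _
      have hnlt : ¬ ‖((2 : ℤ) : ℤ_[p])‖ < 1 := by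
        rw [PadicInt.norm_int_lt_one_iff_dvd]
        intro hd
        have : p ∣ 2 := by exact_mod_cast hd
        exact h2 ((Nat.prime_dvd_prime_iff_eq hp.out Nat.prime_two).mp this)
      push_cast at hle hnlt
      linarith [hle, not_lt.mp hnlt]
    rw [h2', one_pow]
    exact zpow_lt_one_of_neg₀ hp1 (by norm_num)

/-- **Hensel for squares, all `p`**: a `p`-adic integer `u ≡ 1 (mod p³)` is a square in `ℤ_p`
(Hensel's lemma, Mathlib `hensels_lemma`, for `X² - u` at `1`: `‖1 - u‖ ≤ p⁻³ < ‖2‖²`). For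
`p = 2`: Serre, *A Course in Arithmetic*, Ch. II §3.3 Thm 4. [cite: Serre1973, Ch. II §3.3 Thm 4] -/
theorem padicInt_isSquare_of_toZModPow_three_eq_one {u : ℤ_[p]}
    (hu : PadicInt.toZModPow 3 u = 1) : IsSquare u := by
  set F : Polynomial ℤ_[p] := X ^ 2 - C u with hF
  have hF1 : F.aeval (1 : ℤ_[p]) = 1 - u := by simp [hF]
  have hF2 : F.derivative.aeval (1 : ℤ_[p]) = 2 := by
    simp [hF]
    norm_num
  have hmem : 1 - u ∈ (Ideal.span {(p : ℤ_[p]) ^ 3} : Ideal ℤ_[p]) := by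
    have : 1 - u ∈ RingHom.ker (PadicInt.toZModPow 3 : ℤ_[p] →+* ZMod (p ^ 3)) := by
      rw [RingHom.mem_ker, map_sub, map_one, hu, sub_self]
    rwa [PadicInt.ker_toZModPow] at this
  have hnorm1 : ‖F.aeval (1 : ℤ_[p])‖ ≤ (p : ℝ) ^ (-3 : ℤ) := by
    rw [hF1]
    exact_mod_cast (PadicInt.norm_le_pow_iff_mem_span_pow (1 - u) 3).2 hmem
  have hnorm : ‖F.aeval (1 : ℤ_[p])‖ < ‖F.derivative.aeval (1 : ℤ_[p])‖ ^ 2 := by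
    rw [hF2]
    exact lt_of_le_of_lt hnorm1 padicInt_norm_two_sq_gt
  obtain ⟨z, hz, -⟩ := hensels_lemma hnorm
  refine ⟨z, ?_⟩
  have : z ^ 2 - u = 0 := by simpa [hF] using hz
  rw [← sq]
  exact (sub_eq_zero.1 this).symm

/-- **Hensel for squares, odd `p`**: for `p ≠ 2`, a `p`-adic integer `u ≡ 1 (mod p)` is a square
in `ℤ_p` (`‖1 - u‖ ≤ p⁻¹ < 1 = ‖2‖²`; Serre, *A Course in Arithmetic*, Ch. II §3.3 Thm 3: a
`p`-adic unit is a square iff its image in `𝔽_p` is). [cite: Serre1973, Ch. II §3.3 Thm 3] -/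
theorem padicInt_isSquare_of_toZMod_eq_one (hp2 : p ≠ 2) {u : ℤ_[p]}
    (hu : PadicInt.toZMod u = 1) : IsSquare u := by
  set F : Polynomial ℤ_[p] := X ^ 2 - C u with hF
  have hF1 : F.aeval (1 : ℤ_[p]) = 1 - u := by simp [hF]
  have hF2 : F.derivative.aeval (1 : ℤ_[p]) = 2 := by
    simp [hF]
    norm_num
  have h2 : ‖(2 : ℤ_[p])‖ = 1 := by
    have hle : ‖((2 : ℤ) : ℤ_[p])‖ ≤ 1 := PadicInt.norm_le_one _
    have hnlt : ¬ ‖((2 : ℤ) : ℤ_[p])‖ < 1 := by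
      rw [PadicInt.norm_int_lt_one_iff_dvd]
      intro hd
      have : p ∣ 2 := by exact_mod_cast hd
      exact hp2 ((Nat.prime_dvd_prime_iff_eq hp.out Nat.prime_two).mp this)
    push_cast at hle hnlt
    linarith [hle, not_lt.mp hnlt]
  have hlt : ‖1 - u‖ < 1 := by
    have : 1 - u ∈ RingHom.ker (PadicInt.toZMod : ℤ_[p] →+* ZMod p) := by
      rw [RingHom.mem_ker, map_sub, map_one, hu, sub_self]
    rw [PadicInt.ker_toZMod, IsLocalRing.mem_maximalIdeal, PadicInt.mem_nonunits] at this
    exact this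
  have hnorm : ‖F.aeval (1 : ℤ_[p])‖ < ‖F.derivative.aeval (1 : ℤ_[p])‖ ^ 2 := by
    rw [hF1, hF2, h2, one_pow]
    exact hlt
  obtain ⟨z, hz, -⟩ := hensels_lemma hnorm
  refine ⟨z, ?_⟩
  have : z ^ 2 - u = 0 := by simpa [hF] using hz
  rw [← sq]
  exact (sub_eq_zero.1 this).symm

/-! ### Integer representatives of square classes -/

/-- An element of `ℚ_p` at distance `< p⁻³` from `1` is a square (it is a `p`-adic integer
`≡ 1 (mod p³)`). [cite: Serre1973, Ch. II §3.3 Thm 4] -/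
theorem padic_isSquare_of_norm_sub_one_lt {w : ℚ_[p]} (hw : ‖w - 1‖ < (p : ℝ) ^ (-3 : ℤ)) :
    IsSquare w := by
  have hp1 : (1 : ℝ) < p := by exact_mod_cast hp.out.one_lt
  have hw1 : ‖w - 1‖ < 1 := hw.trans (zpow_lt_one_of_neg₀ hp1 (by norm_num))
  -- `w` is a `p`-adic integer
  have hwn : ‖w‖ ≤ 1 := by
    have : w = (w - 1) + 1 := by ring
    rw [this]
    refine (Padic.nonarchimedean _ _).trans (max_le hw1.le ?_)
    simp
  set W : ℤ_[p] := ⟨w, hwn⟩ with hW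
  have hW1 : ‖W - 1‖ ≤ (p : ℝ) ^ (-3 : ℤ) := by
    have : ‖W - 1‖ = ‖w - 1‖ := rfl
    rw [this]
    exact hw.le
  have hmem : W - 1 ∈ (Ideal.span {(p : ℤ_[p]) ^ 3} : Ideal ℤ_[p]) :=
    (PadicInt.norm_le_pow_iff_mem_span_pow (W - 1) 3).1 (by exact_mod_cast hW1)
  have hker : W - 1 ∈ RingHom.ker (PadicInt.toZModPow 3 : ℤ_[p] →+* ZMod (p ^ 3)) := by
    rwa [PadicInt.ker_toZModPow]
  have hW3 : PadicInt.toZModPow 3 W = 1 := by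
    rw [RingHom.mem_ker, map_sub, map_one, sub_eq_zero] at hker
    exact hker
  obtain ⟨S, hS⟩ := padicInt_isSquare_of_toZModPow_three_eq_one hW3
  refine ⟨(S : ℚ_[p]), ?_⟩
  have : ((W : ℤ_[p]) : ℚ_[p]) = w := rfl
  rw [← this, hS, PadicInt.coe_mul]

/-- In `ℚ_p`, if `‖x - r‖ < ‖x‖` then `‖r‖ = ‖x‖` (ultrametric inequality). [folklore] -/
theorem padic_norm_eq_of_norm_sub_lt {x r : ℚ_[p]} (h : ‖x - r‖ < ‖x‖) : ‖r‖ = ‖x‖ := by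
  by_contra hne
  have hne' : ‖x‖ ≠ ‖-r‖ := by rw [norm_neg]; exact fun h => hne h.symm
  have := Padic.add_eq_max_of_ne hne'
  rw [← sub_eq_add_neg, norm_neg] at this
  have : ‖x‖ ≤ ‖x - r‖ := by rw [this]; exact le_max_left _ _
  linarith

/-- **Integer representatives of square classes of `ℚ_p^*`**: every non-zero `x ∈ ℚ_p` is
`x = n · s²` with `n ∈ ℤ ∖ {0}` and `s ∈ ℚ_p^*`. Proof: by density of `ℚ` in `ℚ_p` (Mathlib
`Padic.rat_dense`) choose `r ∈ ℚ` with `‖x - r‖ < p⁻³ ‖x‖`; then `‖r‖ = ‖x‖`, `x / r` is at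
distance `< p⁻³` from `1` hence a square (`padic_isSquare_of_norm_sub_one_lt`), and
`r = (num r · den r) · (den r)⁻²`. (Square classes of `ℚ_p`: Serre, *A Course in Arithmetic*,
Ch. II §3.3, Cor. to Thms 3–4.) [cite: Serre1973, Ch. II §3.3] -/
theorem padic_exists_intCast_mul_sq (x : ℚ_[p]) (hx : x ≠ 0) :
    ∃ (n : ℤ) (s : ℚ_[p]), n ≠ 0 ∧ s ≠ 0 ∧ x = (n : ℚ_[p]) * s ^ 2 := by
  have hp1 : (1 : ℝ) < p := by exact_mod_cast hp.out.one_lt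
  have hxn : 0 < ‖x‖ := norm_pos_iff.mpr hx
  have hε : 0 < ‖x‖ * (p : ℝ) ^ (-3 : ℤ) := mul_pos hxn (zpow_pos (by linarith) _)
  obtain ⟨r, hr⟩ := Padic.rat_dense p x hε
  -- `‖r‖ = ‖x‖`, so `r ≠ 0`
  have hlt : ‖x - r‖ < ‖x‖ := by
    refine hr.trans_le ?_
    have : (p : ℝ) ^ (-3 : ℤ) ≤ 1 := (zpow_lt_one_of_neg₀ hp1 (by norm_num)).le
    nlinarith
  have hrn : ‖(r : ℚ_[p])‖ = ‖x‖ := padic_norm_eq_of_norm_sub_lt hlt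
  have hr0 : (r : ℚ_[p]) ≠ 0 := fun h => by
    rw [h, norm_zero] at hrn
    exact hxn.ne' hrn.symm
  have hr0' : r ≠ 0 := fun h => hr0 (by rw [h, Rat.cast_zero])
  -- `w = x / r` is a square
  set w : ℚ_[p] := x / r with hw
  have hw1 : ‖w - 1‖ < (p : ℝ) ^ (-3 : ℤ) := by
    have : w - 1 = (x - r) / r := by rw [hw]; field_simp
    rw [this, norm_div, hrn, div_lt_iff₀ hxn]
    linarith
  obtain ⟨S, hS⟩ := padic_isSquare_of_norm_sub_one_lt hw1
  have hS0 : S ≠ 0 := by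
    rintro rfl
    have : w = 0 := by rw [hS, mul_zero]
    rw [hw, div_eq_zero_iff] at this
    exact this.elim hx hr0
  -- `x = r · S² = (num · den) · (S / den)²`
  have hden : (r.den : ℚ_[p]) ≠ 0 := by exact_mod_cast r.den_nz
  refine ⟨r.num * r.den, S / r.den, mul_ne_zero (Rat.num_ne_zero.mpr hr0') (by exact_mod_cast r.den_nz),
    div_ne_zero hS0 hden, ?_⟩
  have hxw : x = r * w := by rw [hw]; field_simp
  have hr' : (r : ℚ_[p]) = (r.num : ℚ_[p]) / (r.den : ℚ_[p]) := by
    rw [← Rat.cast_intCast, ← Rat.cast_natCast, ← Rat.cast_div, Rat.num_div_den]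
  rw [hxw, hS, hr']
  field_simp
  push_cast
  ring

end Literature.NumberTheory.QuadraticForms
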